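import Summits.Ventures.HodgeRepro2.T5BergmanLowestWeight

/-!
# The Cartan decomposition `SU(1,1) = K A⁺ K`

Every `g = su11 α β ∈ SU(1,1)` is `rot u · a_t · rot v` with `u, v ∈ Circle` and `t ≥ 0`, where
`a_t = su11 (cosh t) (sinh t)` is the hyperbolic one-parameter subgroup: `rot u · su11 a b · rot v =
su11 (u v a) (u v̄ b)`, so it suffices to absorb the phases of `α` and `β` into `u v` and `u v̄`
(`u² = (phase α)(phase β)`, `v = (phase α)/u`) and to write `(|α|, |β|) = (cosh t, sinh t)` with
`t = arsinh |β|`.  This is the `g = k(ψ₁) a(η) k(ψ₂)` of Rühl's matrix elements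
`exp{i(q₁ψ₁ + q₂ψ₂)} d^J_{q₁q₂}(cosh η)` (Rühl 1970 §6-4), with `η = 2t` and `|α| = cosh(η/2)`;
combined with the bi-`K`-equivariance `coeff_rot_mul_rot` it gives the lowest-weight matrix
coefficient in the printed bicovariant form (`T5BergmanRuhlModel.coeff_cartan`).

Blind lane: Mathlib + the HodgeRepro2 prefix only; no sorry; axioms ⊆ {propext, Classical.choice,
Quot.sound}.
-/

namespace Summit.Ventures.HodgeRepro2.T5SU11Cartan

open T5PoincareDensity T5SU11Unimodular T5SU11Fibration T5BergmanCoefficient T5BergmanLowestWeight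

/-! ### The hyperbolic subgroup -/

/-- `cosh² t - sinh² t = 1` in the form needed for `toSU11`. -/
lemma normSq_cosh_sub_normSq_sinh (t : ℝ) :
    Complex.normSq (Real.cosh t : ℂ) - Complex.normSq (Real.sinh t : ℂ) = 1 := by
  rw [Complex.normSq_ofReal, Complex.normSq_ofReal, ← sq, ← sq]
  exact Real.cosh_sq_sub_sinh_sq t

/-- The hyperbolic element `a_t = su11 (cosh t) (sinh t) ∈ SU(1,1)`. -/
noncomputable def hyp (t : ℝ) : SU11 :=
  toSU11 (Real.cosh t : ℂ) (Real.sinh t : ℂ) (normSq_cosh_sub_normSq_sinh t)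

/-- The matrix of `a_t`. -/
lemma mat_hyp (t : ℝ) : mat (hyp t) = su11 (Real.cosh t : ℂ) (Real.sinh t : ℂ) := rfl

/-- `a_t · 0 = tanh t`. -/
lemma orbit_hyp (t : ℝ) : orbit (hyp t) = (Real.tanh t : ℂ) := by
  unfold hyp
  rw [orbit_toSU11, Complex.conj_ofReal, Real.tanh_eq_sinh_div_cosh, Complex.ofReal_div]

/-- `a_t = s(tanh t)`: the hyperbolic element is the section at the real point `tanh t`. -/
lemma sec_tanh (t : ℝ) : sec (Real.tanh t : ℂ) = hyp t := by
  have hlt : Complex.normSq (Real.tanh t : ℂ) < 1 := by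
    rw [Complex.normSq_ofReal, ← sq]
    have h1 := Real.tanh_lt_one t
    have h2 := Real.neg_one_lt_tanh t
    nlinarith
  have hrad : rad (Real.tanh t : ℂ) = Real.cosh t := by
    unfold rad clamp
    rw [if_pos hlt, Complex.normSq_ofReal, ← sq, T5CartanCoordinates.one_sub_tanh_sq,
      Real.sqrt_div' _ (sq_nonneg _), Real.sqrt_one, Real.sqrt_sq (Real.cosh_pos t).le, one_div,
      inv_inv]
  apply Subtype.ext
  apply Subtype.ext
  show su11 _ _ = su11 _ _
  rw [hrad, clamp, if_pos hlt, ← Complex.ofReal_mul, Real.tanh_eq_sinh_div_cosh,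
    mul_div_cancel₀ _ (Real.cosh_pos t).ne']

/-! ### Conjugating by rotations -/

/-- `rot u · su11 a b · rot v = su11 (u v a) (u v̄ b)`. -/
lemma mat_rot_mul_mul_rot (u v : Circle) (g : SU11) :
    mat (rot u * g * rot v) =
      su11 ((u : ℂ) * v * mat g 0 0) ((u : ℂ) * (starRingEnd ℂ) (v : ℂ) * mat g 0 1) := by
  have hg := coe_eq_su11 g
  show ((((rot u * g * rot v : SU11) : Matrix.SpecialLinearGroup (Fin 2) ℂ)) :
    Matrix (Fin 2) (Fin 2) ℂ) = _
  rw [Subgroup.coe_mul, Subgroup.coe_mul, Matrix.SpecialLinearGroup.coe_mul,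
    Matrix.SpecialLinearGroup.coe_mul, coe_rot, coe_rot]
  rw [show ((g : Matrix.SpecialLinearGroup (Fin 2) ℂ) : Matrix (Fin 2) (Fin 2) ℂ) =
    su11 (mat g 0 0) (mat g 0 1) from hg]
  ext i j
  fin_cases i <;> fin_cases j <;> simp [su11, Matrix.mul_apply, Fin.sum_univ_two] <;> ring

/-- `rot u · a_t · rot v = su11 (u v cosh t) (u v̄ sinh t)`. -/
lemma mat_rot_mul_hyp_mul_rot (u v : Circle) (t : ℝ) :
    mat (rot u * hyp t * rot v) =
      su11 ((u : ℂ) * v * Real.cosh t) ((u : ℂ) * (starRingEnd ℂ) (v : ℂ) * Real.sinh t) := by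
  rw [mat_rot_mul_mul_rot, mat_hyp]
  simp [su11]

/-! ### Existence of the decomposition -/

/-- The phase of a complex number as an element of the circle (`1` at `0`). -/
noncomputable def phase (z : ℂ) : Circle :=
  if h : z = 0 then 1 else ⟨z / ‖z‖, mem_sphere_zero_iff_norm.mpr (by
    rw [norm_div, Complex.norm_real, Real.norm_eq_abs, abs_of_pos (norm_pos_iff.mpr h),
      div_self (norm_ne_zero_iff.mpr h)])⟩

/-- `z = phase z · |z|`. -/
lemma phase_mul_norm (z : ℂ) : (phase z : ℂ) * ‖z‖ = z := by
  unfold phase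
  split_ifs with h
  · simp [h]
  · simp only
    rw [div_mul_cancel₀ _ (by exact_mod_cast norm_ne_zero_iff.mpr h)]

/-- **The Cartan decomposition**: every `g ∈ SU(1,1)` is `rot u · a_t · rot v` with `t ≥ 0`. -/
theorem exists_cartan (g : SU11) :
    ∃ (u v : Circle) (t : ℝ), 0 ≤ t ∧ g = rot u * hyp t * rot v := by
  set α := mat g 0 0 with hα
  set β := mat g 0 1 with hβ
  have hab : Complex.normSq α - Complex.normSq β = 1 := normSq_sub_normSq g
  -- `t = arsinh |β|`, so `sinh t = |β|` and `cosh t = |α|`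
  set t : ℝ := Real.arsinh ‖β‖ with ht
  have hsinh : Real.sinh t = ‖β‖ := Real.sinh_arsinh _
  have hcosh : Real.cosh t = ‖α‖ := by
    rw [ht, Real.cosh_arsinh, ← Complex.normSq_eq_norm_sq, show Complex.normSq β = Complex.normSq α - 1 by
      linarith, show (1 : ℝ) + (Complex.normSq α - 1) = Complex.normSq α by ring,
      Complex.normSq_eq_norm_sq, Real.sqrt_sq (norm_nonneg _)]
  -- the phases: `u² = phase α · phase β`, `v = phase α / u`
  obtain ⟨w, hw⟩ := exists_inv_sq_eq (phase α * phase β)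
  refine ⟨w⁻¹, phase α * w, t, Real.arsinh_nonneg_iff.mpr (norm_nonneg _), ?_⟩
  have hg : mat g = su11 α β := by
    rw [hα, hβ]
    exact coe_eq_su11 g
  apply Subtype.ext
  apply Subtype.ext
  show mat g = mat (rot w⁻¹ * hyp t * rot (phase α * w))
  rw [mat_rot_mul_hyp_mul_rot, hg, hcosh, hsinh]
  have e1 : ((w⁻¹ : Circle) : ℂ) * ((phase α * w : Circle) : ℂ) * (‖α‖ : ℂ) = α := by
    rw [Circle.coe_mul, Circle.coe_inv]
    have hw0 : (w : ℂ) ≠ 0 := Circle.coe_ne_zero w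
    rw [show ((w : ℂ))⁻¹ * ((phase α : ℂ) * w) = (phase α : ℂ) by field_simp, phase_mul_norm]
  have e2 : ((w⁻¹ : Circle) : ℂ) * (starRingEnd ℂ) ((phase α * w : Circle) : ℂ) * (‖β‖ : ℂ) = β := by
    have hw2 : ((w : ℂ))⁻¹ ^ 2 = (phase α : ℂ) * (phase β : ℂ) := by
      have := congrArg (fun x : Circle => (x : ℂ)) hw
      rw [sq, Circle.coe_mul, Circle.coe_mul, Circle.coe_inv, ← sq] at this
      exact this
    rw [← Circle.coe_inv_eq_conj, Circle.coe_inv, Circle.coe_inv, Circle.coe_mul]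
    have hpa : (phase α : ℂ) ≠ 0 := Circle.coe_ne_zero _
    have hw0 : (w : ℂ) ≠ 0 := Circle.coe_ne_zero w
    rw [show ((w : ℂ))⁻¹ * ((phase α : ℂ) * w)⁻¹ = ((w : ℂ))⁻¹ ^ 2 * (phase α : ℂ)⁻¹ by
        field_simp, hw2,
      show (phase α : ℂ) * (phase β : ℂ) * (phase α : ℂ)⁻¹ = (phase β : ℂ) by field_simp,
      phase_mul_norm]
  rw [e1, e2]

end Summit.Ventures.HodgeRepro2.T5SU11Cartan
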